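import Mathlib
import HarnessLib
import Summits.Parity.GeneralizedHardyLittlewood.Theses.SiegelSpectrumSplit

/-!
# Route `SiegelSpectrumSplit`, glue item `UpperGivenBoundedSiegelGlue` (split gen 1 of the upper residual leaf)

The glue of the quantifier-order split (decomp-parity node «TupleUniformitySplit», G1.2) of the leaf
`UpperGivenBoundedSiegel`: `FixedUpper → UniformUpperGivenFixed → UpperGivenBoundedSiegel`.
`UniformUpperGivenFixed` is literally «Q → FixedUpper → (the upper one-sided shift-uniform block)» and
`UpperGivenBoundedSiegel` is «Q → (the same block)», so the glue is argument re-ordering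
(the lens-5 g3 package `SplitGlue.lean` proves it as `fun hF hU hQ => hU hQ hF`, rfl-checked against
the born parent texts). One-line hand requested on the cell bus (STATUS l.121).
-/

namespace Summit.Parity.GeneralizedHardyLittlewood.Theses.SiegelSpectrumSplit

/-- **`UpperGivenBoundedSiegelGlue` holds**: `FixedUpper → UniformUpperGivenFixed → UpperGivenBoundedSiegel`,
by feeding the bounded-Siegel-quality hypothesis and the fixed-pattern half to the uniformity bridge. -/
theorem upperGivenBoundedSiegelGlue_holds : UpperGivenBoundedSiegelGlue :=
  fun hF hU hQ => hU hQ hF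

end Summit.Parity.GeneralizedHardyLittlewood.Theses.SiegelSpectrumSplit
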